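import Literature.NumberTheory.EllipticCurves.Rank1Residual.Typed.X5DescentSelmer
import Literature.NumberTheory.EllipticCurves.Rank1Residual.Typed.X5DescentRoute
import HarnessLib

/-!
# X5 (p = 2): engine-H MODE S over the tree's Selmer groups

Support file for the BSD rank-≤ 1 residual programme, class X5 (`p = 2`), unit `b2b-bsdres-sha-1`
(gen 5). Everything here is proved; the only named fact entering is the hypothesis `hGZK` of the
consumer (no Cassels–Tate pairing is needed in mode S).

File `X5DescentRoute` reads the mode-S verdict of the explicit 8-descent ("no element of exact
order `4` of `Ш` is twice an element") as the stabilisation `Ш[8] = Ш[4]`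
(`stable_four_of_forall_not_divisible`, `X5.descentCertificateAt_of_eightDescent`). File
`X5DescentSelmer` typed ONE engine-H item over the tree's `Sel^(4)`, `Sel^(8)`, `Ш`. Here the
WHOLE mode-S verdict is typed the same way and shown to imply the `Ш`-level statement:

* `X5.forall_not_two_divisible_of_selmer_modeS`: if EVERY `s ∈ Sel^(4)(E/ℚ)` with `2·π₄(s) ≠ 0`
  (every everywhere-locally-soluble 4-covering above a non-trivial element of `Ш[2]`) has NO
  `z ∈ Sel^(8)(E/ℚ)` with `[2]_* z = s` (empty fake 8-Selmer set above it), then no element of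
  exact order `4` of `Ш(E/ℚ)` is divisible by `2` — by `Sel^(4) ↠ Ш[4]` (`exists_selmerToSha_eq`)
  and `π₄(s) ∈ 2Ш ⟹ s ∈ [2]_* Sel^(8)` (`two_divisible_iff_mem_range` with the discharged
  `hcomm`/`hsurj`/`hker` of file `X5DescentSelmer`);
* `X5.descentCertificateAt_of_selmer_modeS`, `X5.bsdp_two_of_selmer_modeS`: with `#Ш[4] = 16`
  and `ord₂ #Ш_an = 4` this is the X5 descent datum at level `2`, hence `BSD(E, 2)` granted GZK.

This is the precise tree-level meaning of the census verdict "H-EXACT (mode S)" (`SHA-CENSUS.md`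
§2.7, §3.6; `METHOD-H.md` §3): finitely many Selmer classes, each with an empty fake Selmer set.

References: Stamminger (2005), Thm. 6.2.2, §1.3; Silverman, *AEC* (2009), Thm. X.4.2;
Miller (2011), Def. 1.1.
-/

noncomputable section

open scoped Classical

open WeierstrassCurve Literature.NumberTheory.EllipticCurves

namespace Literature.NumberTheory.EllipticCurves.Rank1Residual.Typed

variable (W : WeierstrassCurve ℚ) [W.IsElliptic] [W.IsGloballyMinimal]

/-- Arithmetic side condition `8 ∣ 4·2` for `[2]_* : Sel^(8) → Sel^(4)` (content-free private
helper). [folklore] -/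
private theorem eight_dvd' : (8 : ℤ) ∣ 4 * 2 := by norm_num

omit [W.IsGloballyMinimal] in
/-- **Mode S, Selmer form ⟹ `Ш`-form.** If every `s ∈ Sel^(4)(E/ℚ)` with `2·π₄(s) ≠ 0` lies
outside `[2]_* Sel^(8)(E/ℚ)`, then no element of exact order `4` of `Ш(E/ℚ)` is twice an element
(the hypothesis shape of `stable_four_of_forall_not_divisible` / `X5.descentCertificateAt_of_eightDescent`).
[cite: Stamminger2005, Thm. 6.2.2; SilvermanAEC2009, Thm. X.4.2(a)] -/
theorem X5.forall_not_two_divisible_of_selmer_modeS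
    (hS : ∀ s : W.selmerGroup 4, 2 • W.selmerToSha 4 s ≠ 0 →
      ¬ ∃ z : W.selmerGroup 8, W.selmerZSMul 2 eight_dvd' z = s) :
    ∀ y : W.sha, (∃ x : W.sha, 2 • x = y) → 4 • y = 0 → 2 • y = 0 := by
  intro y hy h4
  by_contra h2
  -- `y = π₄(s)` for some `s ∈ Sel^(4)` (`Sel^(4) ↠ Ш[4]`)
  obtain ⟨s, rfl⟩ := W.exists_selmerToSha_eq (n := 4) (by norm_num) y (by rw [ofNat_zsmul]; exact h4)
  -- `π₄(s) ∈ 2Ш ⟹ s ∈ [2]_* Sel^(8)` over the discharged diagram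
  have hcomm : ∀ z : W.selmerGroup 8,
      W.selmerToSha 4 (W.selmerZSMul 2 eight_dvd' z) = 2 • W.selmerToSha 8 z := fun z ↦ by
    rw [selmerToSha_selmerZSMul]; exact ofNat_zsmul _ _
  have hsurj : ∀ w : W.sha, 8 • w = 0 → ∃ z : W.selmerGroup 8, W.selmerToSha 8 z = w :=
    fun w hw ↦ W.exists_selmerToSha_eq (by norm_num) w (by rw [ofNat_zsmul]; exact hw)
  have hker : ∀ s' : W.selmerGroup 4, W.selmerToSha 4 s' = 0 →
      ∃ z : W.selmerGroup 8, W.selmerZSMul 2 eight_dvd' z = s' :=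
    fun s' hs' ↦ W.exists_selmerZSMul_eq_of_selmerToSha_eq_zero 2 (by norm_num) (by norm_num) s' hs'
  exact hS s h2 ((two_divisible_iff_mem_range (W.selmerToSha 4) (W.selmerToSha 8)
    (W.selmerZSMul 2 eight_dvd') hcomm hsurj hker h4).mp hy)

omit [W.IsGloballyMinimal] in
/-- **Mode S over the Selmer groups gives the X5 descent datum at level 2** (with `#Ш[4] = 16`
and `ord₂ #Ш_an = 4`). [cite: Stamminger2005, Thm. 6.2.2; Miller2011LMS, Def. 1.1] -/
theorem X5.descentCertificateAt_of_selmer_modeS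
    (hS : ∀ s : W.selmerGroup 4, 2 • W.selmerToSha 4 s ≠ 0 →
      ¬ ∃ z : W.selmerGroup 8, W.selmerZSMul 2 eight_dvd' z = s)
    (hcard : Nat.card (AddSubgroup.torsionBy W.sha 4) = 16)
    {q : ℚ} (hq : shaAn W = (q : ℂ)) (hv : padicValRat 2 q = 4) : X5.DescentCertificateAt W :=
  X5.descentCertificateAt_of_eightDescent W (X5.forall_not_two_divisible_of_selmer_modeS W hS)
    hcard hq hv

/-- **X5, `p = 2`, MODE S: finitely many Selmer classes certify `BSD(E, 2)`** (granted GZK; no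
Cassels–Tate pairing needed): analytic rank `≤ 1`, every `s ∈ Sel^(4)(E/ℚ)` above a non-trivial
element of `Ш[2]` has an empty fake 8-Selmer set (`s ∉ [2]_* Sel^(8)(E/ℚ)`), `#Ш[4] = 16`,
`ord₂ #Ш_an = 4`. [cite: Stamminger2005, Thm. 6.2.2; Miller2011LMS, Def. 1.1; SilvermanAEC2009, Thm. X.4.2(a)] -/
theorem X5.bsdp_two_of_selmer_modeS (hGZK : rank_eq_analyticRank_of_analyticRank_le_one)
    (hr : W.analyticRank ≤ 1)
    (hS : ∀ s : W.selmerGroup 4, 2 • W.selmerToSha 4 s ≠ 0 →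
      ¬ ∃ z : W.selmerGroup 8, W.selmerZSMul 2 eight_dvd' z = s)
    (hcard : Nat.card (AddSubgroup.torsionBy W.sha 4) = 16)
    {q : ℚ} (hq : shaAn W = (q : ℂ)) (hv : padicValRat 2 q = 4) : BSDp W 2 :=
  X5.bsdp_two_of_descentCertificateAt W hGZK hr (X5.descentCertificateAt_of_selmer_modeS W hS hcard hq hv)

end Literature.NumberTheory.EllipticCurves.Rank1Residual.Typed

end
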